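/-
Copyright (c) 2026 the pub-hodgecm-mathlib formalisation cell (harness21).  Prover seat hodgecm-mathlib-K2Liu-p13 (g0), Track B «K2-LIT»,
#184♮ = hLiu418 = `stmt-HodgeConjecture-24832`; Road I v3 organ U1-CT-ind STAGE 2 (Q2) (SIGS v3.17 §U1 hand of record; census
`K2/K2Liu-p13/g0/CENSUS-Q2-KlingenConstantTerm.K2Liu-p13-g0.md` 22b7515c9c43e994, file F1).
-/
import Summits.HodgeConjecture.HodgeConjecture.Theorems.K2LiuDoubledUTwoTwoLevi   -- ★ B1a-1∕2∕3 (K2Liu-p03): letters, Weyl letters, `leviElt`, `antidiagTwo`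
import HarnessLib

/-!
# Crux `HLiu418`, Road I v3, organ U1 stage 2 (Q2), file F1: THE KLINGEN PARABOLIC OF `U(J₄)` — the Siegel and Klingen subgroups by their zero patterns,
# the Klingen Levi letter `m_Q(a, g′) = diag(a, g′, σ(a)⁻¹)`, the Heisenberg unipotent `n_Q(y, z, t)`, and the cell representative `ξ = w₂ w₁`

Cell `hodgecm-mathlib`, crux item hLiu418 = `stmt-HodgeConjecture-24832`; squad K2 ∕ K2Liu; LEAD F0P6-plan (g13), co-dealer K2E5-plan (g6); prover K2Liu-p13 (g0).
DEFINITIONS WITH BODIES + their algebra (review lane `--kind definition`, `--supports stmt-HodgeConjecture-24832 --as helper`); no `instance`, no notation,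
no named-fact hypothesis, no `sorry`.  Pure algebra over a commutative ring `R` with a ring endomorphism `σ` (involutive where stated), in the frame of
★ B1a `K2LiuDoubledUTwoTwoBorelFrame` ∕ `…WeylCocycle` ∕ `…Levi` (K2Liu-p03): `J₄ = antidiag(1,1,1,1)`, `G = U(J₄)(R, σ) = unitaryGroupOfForm σ ((StdForm.antidiagonal 4).over R)`,
indices `Fin 4 = {0,1,2,3}`, relative root system `C₂` with `α₁ = e₁ − e₂` (short), `α₂ = 2e₂` (long).

WHY.  The Q-constant term of the Siegel Eisenstein series on `U(2,2)` (organ U1-CT-ind stage 2, [Xiong2013 L.7.1], [GanTakeda2011SiegelWeil §7.2]) lives on the KLINGEN parabolic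
`Q = P_{α₂} = Stab(R e₀)`; the Siegel parabolic is `P = P_{α₁} = Stab(R e₀ ⊕ R e₁)`.  This leaf gives both as subgroups of `U(J₄)` CUT OUT BY ZERO PATTERNS (no
decomposition theory), the Klingen Levi `GL₁ × U(J₂)` — whose `U(J₂)` factor on the coordinates `{1, 2}` is LITERALLY E1's `U(Φ₂) = unitaryGroupOfForm σ antidiag(1,1)`
(★ `K2E1BruhatCosetsU`, ★ `K2E1BorelEisensteinU2FromK2Liu`) — the Heisenberg unipotent radical `N_Q = ⟨u_{2e₁}, u_{e₁+e₂}, u_{e₁−e₂}⟩` in B1a's letters, the representative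
`ξ = w₂ w₁` of the non-trivial double coset of `P\G∕Q` (`ξ e₀ = e₂`), and the tables the two-cell unfolding needs:
* §1 `siegelFour` (`P`: lower-left `2 × 2` block zero) and `klingen` (`Q`: `g₁₀ = g₂₀ = g₃₀ = 0`) as `Subgroup`s; `uLongOne, uLongTwo, uPlus, uMinus, torusElt` lie in BOTH
  (so the Borel `B ≤ P ∩ Q`); `weylOne ∈ P`, `weylTwo ∈ Q`.
* §2 `antidiagonal_over_two` (`(StdForm.antidiagonal 2).over R = antidiagTwo`), the entry relations of a `U(J₂)` element, and THE KLINGEN LEVI LETTER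
  `klingenLevi a g′ = diag(a, g′, σ(a)⁻¹) ∈ U(J₄)` (`a ∈ Rˣ`, `g′ ∈ U(J₂)(R, σ)`): multiplicative in `(a, g′)`, in `Q`, and `∈ P ↔ g′₁₀ = 0` (E1's Borel corner test) — with
  `u_{2e₂}(x) = klingenLevi 1 (unipotent of U(J₂))`: the long simple root group IS the Levi's unipotent.
* §3 THE HEISENBERG UNIPOTENT `nKlingen y z t := u_{2e₁}(y) · u_{e₁+e₂}(z) · u_{e₁−e₂}(t)` (`σ y = −y`), its matrix, `nKlingen ∈ P ∩ Q` — `N_Q ≤ P`, the reason the identity cell of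
  the Q-constant term is `vol · f` — and normalisation by the Levi letter.
* §4 THE CELL REPRESENTATIVE `weylXi := weylTwo * weylOne` (matrix = the permutation `0 ↦ 2 ↦ 3 ↦ 1 ↦ 0` on basis vectors, `ξ e₀ = e₂`), `ξ ∉ Q`, `ξ ∉ P`, and the conjugation
  table on `N_Q`: `ξ · u_{e₁+e₂}(z) = u_{e₁−e₂}(−σ z) · ξ` (stays in `P`), while `ξ u_{2e₁}(y) ξ⁻¹`, `ξ u_{e₁−e₂}(t) ξ⁻¹` are LOWER unitriangular (`∉ P` for `y ≠ 0`, `t ≠ 0`): the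
  two flipped roots `{2e₁, e₁−e₂}` are the integration variables of the cell-`ξ` intertwiner `M(ξ, s) f = ∫∫ f(ξ u_{2e₁}(y) u_{e₁−e₂}(t) ·) dy dt`.
File F2 (`K2LiuKlingenBruhatTwoCells`, over a field): `G = P·Q ⊔ P·ξ·Q` by the column test `(g e₀)₂ = (g e₀)₃ = 0`.
[Xiong2013 = corpus:paper-arxiv-1205.6025, §4 Prop. 4.1, §7 Lemma 7.1], [GanTakeda2011SiegelWeil = corpus:paper-arxiv-0902.0419, §7.2 p. 23], [MoeglinWaldspurger1995, II.1.7], [Casselman1980, §3],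
[Rogawski1990, §1.9], [Mok2014, §1 Notation p. 5].
HONEST LABEL.  Carriers only, count-neutral: `HC_CM` is proved only modulo the 7 printed citations (2 remaining named inputs: hLiu418 = `stmt-HodgeConjecture-24832`,
h413 = `stmt-HodgeConjecture-24833`) until rung 0 closes.
-/

set_option autoImplicit false
set_option linter.dupNamespace false -- the mandated namespace repeats `HodgeConjecture.HodgeConjecture`

noncomputable section

open Matrix
open Literature.NumberTheory.Automorphic
open Summit.HodgeConjecture.HodgeConjecture.Cruxes.HLiu418.K2LiuDoubledUTwoTwoBorelFrame
open Summit.HodgeConjecture.HodgeConjecture.Cruxes.HLiu418.K2LiuDoubledUTwoTwoWeylCocycle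
open Summit.HodgeConjecture.HodgeConjecture.Cruxes.HLiu418.K2LiuDoubledUTwoTwoLevi

namespace Summit.HodgeConjecture.HodgeConjecture.Cruxes.HLiu418.K2LiuKlingenParabolicDefs

variable (R : Type*) [CommRing R] (σ : R →+* R)

/-! ## §1 The Siegel and the Klingen parabolic subgroups of `U(J₄)` by their zero patterns -/

/-- **the Siegel parabolic `P = P_{α₁} ≤ U(J₄)`**: stabiliser of the isotropic plane `R e₀ ⊕ R e₁`, i.e. the lower-left `2 × 2` block vanishes
(`g₂₀ = g₂₁ = g₃₀ = g₃₁ = 0`). [cite: HarrisKudlaSweet1996, §1 (1.11)] [cite: Casselman1980, §3] -/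
def siegelFour : Subgroup (unitaryGroupOfForm σ ((StdForm.antidiagonal 4).over R)) where
  carrier := {g | ((g : GL (Fin 4) R) : Matrix (Fin 4) (Fin 4) R) 2 0 = 0 ∧ ((g : GL (Fin 4) R) : Matrix (Fin 4) (Fin 4) R) 2 1 = 0 ∧
    ((g : GL (Fin 4) R) : Matrix (Fin 4) (Fin 4) R) 3 0 = 0 ∧ ((g : GL (Fin 4) R) : Matrix (Fin 4) (Fin 4) R) 3 1 = 0}
  one_mem' := by
    refine ⟨?_, ?_, ?_, ?_⟩ <;> simp
  mul_mem' := by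
    rintro g h ⟨hg1, hg2, hg3, hg4⟩ ⟨hh1, hh2, hh3, hh4⟩
    refine ⟨?_, ?_, ?_, ?_⟩ <;>
      simp only [Subgroup.coe_mul, Units.val_mul, Matrix.mul_apply, Fin.sum_univ_four, hg1, hg2, hg3, hg4, hh1, hh2, hh3, hh4,
        zero_mul, mul_zero, add_zero]
  inv_mem' := by
    rintro g ⟨hg1, hg2, hg3, hg4⟩
    -- `(g⁻¹ g)ᵢⱼ = δᵢⱼ` read on the lower-left block: `(g⁻¹)₂₀ g₀₀ + (g⁻¹)₂₁ g₁₀ = 0`, … ; solve with the upper-left block of `g g⁻¹ = 1`… instead use `J σ(g)ᵀ J`: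
    have hinv : (((g : GL (Fin 4) R) : Matrix (Fin 4) (Fin 4) R))⁻¹ =
        antidiagFour R * (((g : GL (Fin 4) R) : Matrix (Fin 4) (Fin 4) R).map σ)ᵀ * antidiagFour R := by
      have hg := mem_unitaryGroupOfForm_iff.1 g.2
      -- `g⁻¹ = J σ(g)ᵀ J` since `(J σ(g)ᵀ J) g = J (σ(g)ᵀ J g) = J J = 1`
      have h1 : (StdForm.antidiagonal 4).over R * (((g : GL (Fin 4) R) : Matrix (Fin 4) (Fin 4) R).map σ)ᵀ * (StdForm.antidiagonal 4).over R *
          ((g : GL (Fin 4) R) : Matrix (Fin 4) (Fin 4) R) = 1 := by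
        rw [Matrix.mul_assoc ((StdForm.antidiagonal 4).over R), Matrix.mul_assoc ((StdForm.antidiagonal 4).over R), hg, StdForm.over_mul_over]
      rw [← antidiagonal_over_four]
      exact Matrix.inv_eq_left_inv h1
    have hent : ∀ i j : Fin 4, (((g⁻¹ : unitaryGroupOfForm σ ((StdForm.antidiagonal 4).over R)) : GL (Fin 4) R) : Matrix (Fin 4) (Fin 4) R) i j =
        ∑ k : Fin 4, ∑ l : Fin 4, antidiagFour R i l * σ (((g : GL (Fin 4) R) : Matrix (Fin 4) (Fin 4) R) k l) * antidiagFour R k j := fun i j => by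
      rw [Subgroup.coe_inv, Matrix.coe_units_inv, hinv, Matrix.mul_apply]
      refine Finset.sum_congr rfl fun k _ => ?_
      rw [Matrix.mul_apply, Finset.sum_mul]
      refine Finset.sum_congr rfl fun l _ => ?_
      rw [Matrix.transpose_apply, Matrix.map_apply]
    refine ⟨?_, ?_, ?_, ?_⟩ <;> (rw [hent]; simp [Fin.sum_univ_four, antidiagFour, hg1, hg2, hg3, hg4])

/-- membership in `P`: the four lower-left entries vanish. [cite: HarrisKudlaSweet1996, §1 (1.11)] -/
theorem mem_siegelFour_iff (g : unitaryGroupOfForm σ ((StdForm.antidiagonal 4).over R)) :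
    g ∈ siegelFour R σ ↔ ((g : GL (Fin 4) R) : Matrix (Fin 4) (Fin 4) R) 2 0 = 0 ∧ ((g : GL (Fin 4) R) : Matrix (Fin 4) (Fin 4) R) 2 1 = 0 ∧
      ((g : GL (Fin 4) R) : Matrix (Fin 4) (Fin 4) R) 3 0 = 0 ∧ ((g : GL (Fin 4) R) : Matrix (Fin 4) (Fin 4) R) 3 1 = 0 :=
  Iff.rfl

/-- **the Klingen parabolic `Q = P_{α₂} ≤ U(J₄)`**: stabiliser of the isotropic LINE `R e₀`, i.e. `g₁₀ = g₂₀ = g₃₀ = 0`.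
[cite: Xiong2013, §7 Lemma 7.1] [cite: GanTakeda2011SiegelWeil, §7.2 p. 23] [cite: MoeglinWaldspurger1995, II.1.7] -/
def klingen : Subgroup (unitaryGroupOfForm σ ((StdForm.antidiagonal 4).over R)) where
  carrier := {g | ((g : GL (Fin 4) R) : Matrix (Fin 4) (Fin 4) R) 1 0 = 0 ∧ ((g : GL (Fin 4) R) : Matrix (Fin 4) (Fin 4) R) 2 0 = 0 ∧
    ((g : GL (Fin 4) R) : Matrix (Fin 4) (Fin 4) R) 3 0 = 0}
  one_mem' := by
    refine ⟨?_, ?_, ?_⟩ <;> simp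
  mul_mem' := by
    rintro g h ⟨hg1, hg2, hg3⟩ ⟨hh1, hh2, hh3⟩
    refine ⟨?_, ?_, ?_⟩ <;>
      simp only [Subgroup.coe_mul, Units.val_mul, Matrix.mul_apply, Fin.sum_univ_four, hg1, hg2, hg3, hh1, hh2, hh3,
        zero_mul, mul_zero, add_zero]
  inv_mem' := by
    rintro g ⟨hg1, hg2, hg3⟩
    -- column `0` of `g⁻¹ g = 1`: `(g⁻¹)ᵢ₀ · g₀₀ = δᵢ₀`; so `g₀₀` is a unit and `(g⁻¹)ᵢ₀ = 0` for `i ≠ 0`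
    have hmul : (((g⁻¹ : unitaryGroupOfForm σ ((StdForm.antidiagonal 4).over R)) : GL (Fin 4) R) : Matrix (Fin 4) (Fin 4) R) *
        ((g : GL (Fin 4) R) : Matrix (Fin 4) (Fin 4) R) = 1 := by
      rw [Subgroup.coe_inv, ← Units.val_mul, inv_mul_cancel, Units.val_one]
    have hcol : ∀ i : Fin 4, (((g⁻¹ : unitaryGroupOfForm σ ((StdForm.antidiagonal 4).over R)) : GL (Fin 4) R) : Matrix (Fin 4) (Fin 4) R) i 0 *
        ((g : GL (Fin 4) R) : Matrix (Fin 4) (Fin 4) R) 0 0 = (1 : Matrix (Fin 4) (Fin 4) R) i 0 := fun i => by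
      have h := congrFun (congrFun hmul i) 0
      simpa only [Matrix.mul_apply, Fin.sum_univ_four, hg1, hg2, hg3, mul_zero, add_zero] using h
    have hunit : IsUnit (((g : GL (Fin 4) R) : Matrix (Fin 4) (Fin 4) R) 0 0) :=
      IsUnit.of_mul_eq_one_right _ (by simpa using hcol 0)
    refine ⟨?_, ?_, ?_⟩
    · exact (hunit.mul_left_eq_zero).1 (by simpa using hcol 1)
    · exact (hunit.mul_left_eq_zero).1 (by simpa using hcol 2)
    · exact (hunit.mul_left_eq_zero).1 (by simpa using hcol 3)

/-- membership in `Q`: the first column is a multiple of `e₀`. [cite: Xiong2013, §7 Lemma 7.1] -/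
theorem mem_klingen_iff (g : unitaryGroupOfForm σ ((StdForm.antidiagonal 4).over R)) :
    g ∈ klingen R σ ↔ ((g : GL (Fin 4) R) : Matrix (Fin 4) (Fin 4) R) 1 0 = 0 ∧ ((g : GL (Fin 4) R) : Matrix (Fin 4) (Fin 4) R) 2 0 = 0 ∧
      ((g : GL (Fin 4) R) : Matrix (Fin 4) (Fin 4) R) 3 0 = 0 :=
  Iff.rfl

variable {R σ}

/-- `u_{2e₁}(y) ∈ P ∩ Q`. [cite: Casselman1980, §3] -/
theorem uLongOne_mem (y : R) (hy : σ y = -y) : uLongOne R σ y hy ∈ siegelFour R σ ∧ uLongOne R σ y hy ∈ klingen R σ := by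
  refine ⟨⟨?_, ?_, ?_, ?_⟩, ⟨?_, ?_, ?_⟩⟩ <;> simp [uLongOneM]

/-- `u_{2e₂}(x) ∈ P ∩ Q` (it is the unipotent of the Levi `U(J₂)` of `Q`). [cite: Casselman1980, §3] -/
theorem uLongTwo_mem (x : R) (hx : σ x = -x) : uLongTwo R σ x hx ∈ siegelFour R σ ∧ uLongTwo R σ x hx ∈ klingen R σ := by
  refine ⟨⟨?_, ?_, ?_, ?_⟩, ⟨?_, ?_, ?_⟩⟩ <;> simp [uLongTwoM]

/-- `u_{e₁+e₂}(z) ∈ P ∩ Q`. [cite: Casselman1980, §3] -/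
theorem uPlus_mem (hσ : ∀ x, σ (σ x) = x) (z : R) : uPlus R σ hσ z ∈ siegelFour R σ ∧ uPlus R σ hσ z ∈ klingen R σ := by
  refine ⟨⟨?_, ?_, ?_, ?_⟩, ⟨?_, ?_, ?_⟩⟩ <;> simp [uPlusM]

/-- `u_{e₁−e₂}(t) ∈ P ∩ Q` (the short simple root group: inside the Siegel LEVI and inside `N_Q`). [cite: Casselman1980, §3] -/
theorem uMinus_mem (hσ : ∀ x, σ (σ x) = x) (t : R) : uMinus R σ hσ t ∈ siegelFour R σ ∧ uMinus R σ hσ t ∈ klingen R σ := by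
  refine ⟨⟨?_, ?_, ?_, ?_⟩, ⟨?_, ?_, ?_⟩⟩ <;> simp [uMinusM]

/-- `t(a, b) ∈ P ∩ Q`. [cite: Casselman1980, §3] -/
theorem torusElt_mem (hσ : ∀ x, σ (σ x) = x) (a b : Rˣ) : torusElt R σ hσ a b ∈ siegelFour R σ ∧ torusElt R σ hσ a b ∈ klingen R σ := by
  refine ⟨⟨?_, ?_, ?_, ?_⟩, ⟨?_, ?_, ?_⟩⟩ <;> simp [torusM]

/-- the Siegel-Levi letter `m(A) ∈ P`. [cite: HarrisKudlaSweet1996, §1 (1.11)] -/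
theorem leviElt_mem_siegelFour (hσ : ∀ x, σ (σ x) = x) (A : GL (Fin 2) R) : leviElt R σ hσ A ∈ siegelFour R σ := by
  refine ⟨?_, ?_, ?_, ?_⟩ <;> simp [leviM]

/-- the Siegel unipotent `n(x, z, y) ∈ P`. [cite: HarrisKudlaSweet1996, §1 (1.11)] -/
theorem nSiegel_mem_siegelFour (hσ : ∀ x, σ (σ x) = x) (x z y : R) (hx : σ x = -x) (hy : σ y = -y) :
    nSiegel R σ hσ x z y hx hy ∈ siegelFour R σ := by
  rw [mem_siegelFour_iff, coe_nSiegel]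
  simp [nSiegelM]

/-- `w₁ ∈ P` (the Siegel-Levi Weyl letter) and `w₁ ∉ Q` is not claimed (it moves `e₀`). [cite: Casselman1980, §3] -/
theorem weylOne_mem_siegelFour : weylOne R σ ∈ siegelFour R σ := by
  refine ⟨?_, ?_, ?_, ?_⟩ <;> simp [weylOneM]

/-- `w₂ ∈ Q` (it fixes `e₀`). [cite: Casselman1980, §3] -/
theorem weylTwo_mem_klingen : weylTwo R σ ∈ klingen R σ := by
  refine ⟨?_, ?_, ?_⟩ <;> simp [weylTwoM]

/-! ## §2 The Klingen Levi letter `m_Q(a, g′) = diag(a, g′, σ(a)⁻¹)` with `g′ ∈ U(J₂)(R, σ)` — E1's `U(Φ₂)` on the coordinates `{1, 2}` -/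

variable (R) in
/-- `(StdForm.antidiagonal 2).over R = antidiag(1,1)` (★ `antidiagTwo`). [cite: Mok2014, §1 Notation p. 5] -/
theorem antidiagonal_over_two : (StdForm.antidiagonal 2).over R = antidiagTwo R := by
  ext i j
  rw [StdForm.over, Matrix.map_apply, StdForm.antidiagonal_J_apply]
  fin_cases i <;> fin_cases j <;> simp [antidiagTwo, Fin.rev]

/-- the four ENTRY RELATIONS `σ(g′)ᵀ antidiag(1,1) g′ = antidiag(1,1)` of an element of `U(J₂)(R, σ)`:
`σ(g₁₀) g₀₀ + σ(g₀₀) g₁₀ = 0`, `σ(g₁₀) g₀₁ + σ(g₀₀) g₁₁ = 1`, `σ(g₁₁) g₀₀ + σ(g₀₁) g₁₀ = 1`, `σ(g₁₁) g₀₁ + σ(g₀₁) g₁₁ = 0`. [cite: Rogawski1990, §1.9] -/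
theorem unitaryTwo_entries (g : unitaryGroupOfForm σ ((StdForm.antidiagonal 2).over R)) :
    σ (((g : GL (Fin 2) R) : Matrix (Fin 2) (Fin 2) R) 1 0) * ((g : GL (Fin 2) R) : Matrix (Fin 2) (Fin 2) R) 0 0 +
        σ (((g : GL (Fin 2) R) : Matrix (Fin 2) (Fin 2) R) 0 0) * ((g : GL (Fin 2) R) : Matrix (Fin 2) (Fin 2) R) 1 0 = 0 ∧
      σ (((g : GL (Fin 2) R) : Matrix (Fin 2) (Fin 2) R) 1 0) * ((g : GL (Fin 2) R) : Matrix (Fin 2) (Fin 2) R) 0 1 +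
        σ (((g : GL (Fin 2) R) : Matrix (Fin 2) (Fin 2) R) 0 0) * ((g : GL (Fin 2) R) : Matrix (Fin 2) (Fin 2) R) 1 1 = 1 ∧
      σ (((g : GL (Fin 2) R) : Matrix (Fin 2) (Fin 2) R) 1 1) * ((g : GL (Fin 2) R) : Matrix (Fin 2) (Fin 2) R) 0 0 +
        σ (((g : GL (Fin 2) R) : Matrix (Fin 2) (Fin 2) R) 0 1) * ((g : GL (Fin 2) R) : Matrix (Fin 2) (Fin 2) R) 1 0 = 1 ∧
      σ (((g : GL (Fin 2) R) : Matrix (Fin 2) (Fin 2) R) 1 1) * ((g : GL (Fin 2) R) : Matrix (Fin 2) (Fin 2) R) 0 1 +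
        σ (((g : GL (Fin 2) R) : Matrix (Fin 2) (Fin 2) R) 0 1) * ((g : GL (Fin 2) R) : Matrix (Fin 2) (Fin 2) R) 1 1 = 0 := by
  have h := mem_unitaryGroupOfForm_iff.1 g.2
  refine ⟨?_, ?_, ?_, ?_⟩
  · simpa [Matrix.mul_apply, Fin.sum_univ_two, antidiagonal_over_two, antidiagTwo] using congrFun (congrFun h 0) 0
  · simpa [Matrix.mul_apply, Fin.sum_univ_two, antidiagonal_over_two, antidiagTwo] using congrFun (congrFun h 0) 1
  · simpa [Matrix.mul_apply, Fin.sum_univ_two, antidiagonal_over_two, antidiagTwo] using congrFun (congrFun h 1) 0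
  · simpa [Matrix.mul_apply, Fin.sum_univ_two, antidiagonal_over_two, antidiagTwo] using congrFun (congrFun h 1) 1

variable (R σ) in
/-- matrix of the Klingen Levi letter `m_Q(a, g′) = diag(a, g′, σ(a⁻¹))`. [cite: Xiong2013, §7 Lemma 7.1] [cite: MoeglinWaldspurger1995, II.1.7] -/
def klingenLeviM (a : Rˣ) (g : unitaryGroupOfForm σ ((StdForm.antidiagonal 2).over R)) : Matrix (Fin 4) (Fin 4) R :=
  !![(a : R), 0, 0, 0;
     0, ((g : GL (Fin 2) R) : Matrix (Fin 2) (Fin 2) R) 0 0, ((g : GL (Fin 2) R) : Matrix (Fin 2) (Fin 2) R) 0 1, 0;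
     0, ((g : GL (Fin 2) R) : Matrix (Fin 2) (Fin 2) R) 1 0, ((g : GL (Fin 2) R) : Matrix (Fin 2) (Fin 2) R) 1 1, 0;
     0, 0, 0, σ ((a⁻¹ : Rˣ) : R)]

/-- `m_Q(a, g′)` preserves `J₄` (`σ` involutive). [cite: Xiong2013, §7 Lemma 7.1] -/
theorem klingenLeviM_unitary (hσ : ∀ x, σ (σ x) = x) (a : Rˣ) (g : unitaryGroupOfForm σ ((StdForm.antidiagonal 2).over R)) :
    ((klingenLeviM R σ a g).map σ)ᵀ * antidiagFour R * klingenLeviM R σ a g = antidiagFour R := by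
  obtain ⟨s1, s2, s3, s4⟩ := unitaryTwo_entries g
  have ha' : σ (a : R) * σ ((a⁻¹ : Rˣ) : R) = 1 := by rw [← map_mul, Units.mul_inv, map_one]
  ext i j
  fin_cases i <;> fin_cases j <;>
    simp [klingenLeviM, antidiagFour, Matrix.mul_apply, Fin.sum_univ_four, hσ, ha'] <;>
    first
    | linear_combination s1
    | linear_combination s2
    | linear_combination s3
    | linear_combination s4

variable (R σ) in
/-- **the Klingen Levi letter `m_Q(a, g′) = diag(a, g′, σ(a)⁻¹) ∈ U(J₄)`** (`a ∈ Rˣ = GL₁`, `g′ ∈ U(J₂)(R, σ)` = E1's `U(Φ₂)` on the coordinates `{1,2}`).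
[cite: Xiong2013, §7 Lemma 7.1] [cite: GanTakeda2011SiegelWeil, §7.2 p. 23] [cite: MoeglinWaldspurger1995, II.1.7] -/
def klingenLevi (hσ : ∀ x, σ (σ x) = x) (a : Rˣ) (g : unitaryGroupOfForm σ ((StdForm.antidiagonal 2).over R)) :
    unitaryGroupOfForm σ ((StdForm.antidiagonal 4).over R) :=
  unitaryOfMatrix' R σ (klingenLeviM R σ a g) (klingenLeviM_unitary hσ a g)

/-- matrix of `klingenLevi`. [cite: Xiong2013, §7 Lemma 7.1] -/
@[simp] theorem coe_klingenLevi (hσ : ∀ x, σ (σ x) = x) (a : Rˣ) (g : unitaryGroupOfForm σ ((StdForm.antidiagonal 2).over R)) :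
    (((klingenLevi R σ hσ a g : unitaryGroupOfForm σ _) : GL (Fin 4) R) : Matrix (Fin 4) (Fin 4) R) = klingenLeviM R σ a g := rfl

/-- **`m_Q` is multiplicative**: `m_Q(a, g) m_Q(a′, g′) = m_Q(a a′, g g′)`. [cite: MoeglinWaldspurger1995, II.1.7] -/
theorem klingenLevi_mul (hσ : ∀ x, σ (σ x) = x) (a a' : Rˣ) (g g' : unitaryGroupOfForm σ ((StdForm.antidiagonal 2).over R)) :
    klingenLevi R σ hσ a g * klingenLevi R σ hσ a' g' = klingenLevi R σ hσ (a * a') (g * g') := by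
  apply ext_of_coe
  rw [Subgroup.coe_mul, Units.val_mul, coe_klingenLevi, coe_klingenLevi, coe_klingenLevi]
  ext i j
  fin_cases i <;> fin_cases j <;> simp [klingenLeviM, Matrix.mul_apply, Fin.sum_univ_four, Fin.sum_univ_two, _root_.mul_inv_rev, mul_comm]

/-- `m_Q(1, 1) = 1`. [cite: MoeglinWaldspurger1995, II.1.7] -/
theorem klingenLevi_one (hσ : ∀ x, σ (σ x) = x) : klingenLevi R σ hσ 1 1 = 1 := by
  apply ext_of_coe
  rw [coe_klingenLevi]
  ext i j
  fin_cases i <;> fin_cases j <;> simp [klingenLeviM]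

/-- `m_Q(a, g′) ∈ Q`. [cite: Xiong2013, §7 Lemma 7.1] -/
theorem klingenLevi_mem_klingen (hσ : ∀ x, σ (σ x) = x) (a : Rˣ) (g : unitaryGroupOfForm σ ((StdForm.antidiagonal 2).over R)) :
    klingenLevi R σ hσ a g ∈ klingen R σ := by
  refine ⟨?_, ?_, ?_⟩ <;> simp [klingenLeviM]

/-- **`m_Q(a, g′) ∈ P ↔ g′₁₀ = 0`** — the Siegel parabolic meets the Klingen Levi in `GL₁ ×` (E1's Borel of `U(Φ₂)`, corner test `g′₁₀ = 0`, ★ `K2E1BruhatCosetsU`).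
[cite: Xiong2013, §7 Lemma 7.1] [cite: MoeglinWaldspurger1995, II.1.7] -/
theorem klingenLevi_mem_siegelFour_iff (hσ : ∀ x, σ (σ x) = x) (a : Rˣ) (g : unitaryGroupOfForm σ ((StdForm.antidiagonal 2).over R)) :
    klingenLevi R σ hσ a g ∈ siegelFour R σ ↔ ((g : GL (Fin 2) R) : Matrix (Fin 2) (Fin 2) R) 1 0 = 0 := by
  rw [mem_siegelFour_iff, coe_klingenLevi]
  simp [klingenLeviM]

/-- the GL₁-factor alone is a torus element: `m_Q(a, 1) = t(a, 1)`. [cite: Casselman1980, §3] -/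
theorem klingenLevi_one_right (hσ : ∀ x, σ (σ x) = x) (a : Rˣ) : klingenLevi R σ hσ a 1 = torusElt R σ hσ a 1 := by
  apply ext_of_coe
  rw [coe_klingenLevi, coe_torusElt]
  ext i j
  fin_cases i <;> fin_cases j <;> simp [klingenLeviM, torusM]

/-! ## §3 The Heisenberg unipotent radical `N_Q = u_{2e₁} · u_{e₁+e₂} · u_{e₁−e₂}` -/

variable (R σ) in
/-- matrix of `n_Q(y, z, t) = u_{2e₁}(y) u_{e₁+e₂}(z) u_{e₁−e₂}(t)`:
`(1, t, z, y − z σ(t); 0, 1, 0, −σ z; 0, 0, 1, −σ t; 0, 0, 0, 1)`. [cite: Xiong2013, §7 Lemma 7.1] [cite: Rogawski1990, §1.9] -/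
def nKlingenM (y z t : R) : Matrix (Fin 4) (Fin 4) R := !![1, t, z, y - z * σ t; 0, 1, 0, -σ z; 0, 0, 1, -σ t; 0, 0, 0, 1]

variable (R σ) in
/-- **the Klingen unipotent letter `n_Q(y, z, t) := u_{2e₁}(y) · u_{e₁+e₂}(z) · u_{e₁−e₂}(t) ∈ U(J₄)`** (`σ y = −y`; a Heisenberg group with centre `u_{2e₁}`).
[cite: Xiong2013, §7 Lemma 7.1] [cite: GanTakeda2011SiegelWeil, §7.2 p. 23] -/
def nKlingen (hσ : ∀ x, σ (σ x) = x) (y : R) (hy : σ y = -y) (z t : R) : unitaryGroupOfForm σ ((StdForm.antidiagonal 4).over R) :=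
  uLongOne R σ y hy * uPlus R σ hσ z * uMinus R σ hσ t

/-- matrix of `nKlingen`. [cite: Xiong2013, §7 Lemma 7.1] -/
theorem coe_nKlingen (hσ : ∀ x, σ (σ x) = x) (y : R) (hy : σ y = -y) (z t : R) :
    (((nKlingen R σ hσ y hy z t : unitaryGroupOfForm σ _) : GL (Fin 4) R) : Matrix (Fin 4) (Fin 4) R) = nKlingenM R σ y z t := by
  rw [nKlingen, Subgroup.coe_mul, Units.val_mul, Subgroup.coe_mul, Units.val_mul, coe_uLongOne, coe_uPlus, coe_uMinus]
  ext i j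
  fin_cases i <;> fin_cases j <;> simp [uLongOneM, uPlusM, uMinusM, nKlingenM, Matrix.mul_apply, Fin.sum_univ_four, sub_eq_neg_add]

/-- **`N_Q ≤ P ∩ Q`**: `n_Q(y, z, t)` lies in the Siegel AND in the Klingen parabolic (so the Siegel section is left-`N_Q(𝔸)`-invariant: the identity cell of the
Q-constant term is `vol · f`). [cite: Xiong2013, §4 Prop. 4.1] [cite: MoeglinWaldspurger1995, II.1.7] -/
theorem nKlingen_mem (hσ : ∀ x, σ (σ x) = x) (y : R) (hy : σ y = -y) (z t : R) :
    nKlingen R σ hσ y hy z t ∈ siegelFour R σ ∧ nKlingen R σ hσ y hy z t ∈ klingen R σ :=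
  ⟨(siegelFour R σ).mul_mem ((siegelFour R σ).mul_mem (uLongOne_mem y hy).1 (uPlus_mem hσ z).1) (uMinus_mem hσ t).1,
    (klingen R σ).mul_mem ((klingen R σ).mul_mem (uLongOne_mem y hy).2 (uPlus_mem hσ z).2) (uMinus_mem hσ t).2⟩

/-- the Siegel-Levi part of `n_Q`: `u_{e₁−e₂}(t) = m((1 t; 0 1))` is the unipotent of the `GL₂`-Levi (★ `leviElt`), so the Siegel character is trivial on it.
[cite: HarrisKudlaSweet1996, §1 (1.11)] -/
theorem uMinus_eq_leviElt (hσ : ∀ x, σ (σ x) = x) (t : R) (A : GL (Fin 2) R) (hA : (A : Matrix (Fin 2) (Fin 2) R) = !![1, t; 0, 1])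
    (hAi : ((A : Matrix (Fin 2) (Fin 2) R))⁻¹ = !![1, -t; 0, 1]) : uMinus R σ hσ t = leviElt R σ hσ A := by
  apply ext_of_coe
  rw [coe_uMinus, coe_leviElt]
  ext i j
  fin_cases i <;> fin_cases j <;> simp only [leviM, hAi] <;> simp [uMinusM, hA]

/-! ## §4 The cell representative `ξ = w₂ w₁` and its action on `N_Q` -/

variable (R) in
/-- matrix of `ξ = w₂ w₁`: the permutation `e₀ ↦ e₂ ↦ e₃ ↦ e₁ ↦ e₀` on basis vectors. [cite: Xiong2013, §7 Lemma 7.1] -/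
def weylXiM : Matrix (Fin 4) (Fin 4) R := !![0, 1, 0, 0; 0, 0, 0, 1; 1, 0, 0, 0; 0, 0, 1, 0]

variable (R σ) in
/-- **the representative `ξ := w₂ · w₁ ∈ U(J₄)` of the non-trivial double coset `P·ξ·Q`** (`P\U(J₄)∕Q = {1, ξ}`, file F2); `ξ e₀ = e₂ ∉ R e₀ ⊕ R e₁`.
[cite: Xiong2013, §7 Lemma 7.1] [cite: GanTakeda2011SiegelWeil, §7.2 p. 23] -/
def weylXi : unitaryGroupOfForm σ ((StdForm.antidiagonal 4).over R) := weylTwo R σ * weylOne R σ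

/-- matrix of `weylXi`. [cite: Xiong2013, §7 Lemma 7.1] -/
theorem coe_weylXi : (((weylXi R σ : unitaryGroupOfForm σ _) : GL (Fin 4) R) : Matrix (Fin 4) (Fin 4) R) = weylXiM R := by
  rw [weylXi, Subgroup.coe_mul, Units.val_mul, coe_weylTwo, coe_weylOne]
  ext i j
  fin_cases i <;> fin_cases j <;> simp [weylTwoM, weylOneM, weylXiM, Matrix.mul_apply, Fin.sum_univ_four]

/-- matrix of `ξ⁻¹ = w₁ w₂` (the inverse permutation). [cite: Xiong2013, §7 Lemma 7.1] -/
theorem coe_weylXi_inv : ((((weylXi R σ)⁻¹ : unitaryGroupOfForm σ _) : GL (Fin 4) R) : Matrix (Fin 4) (Fin 4) R) =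
    !![0, 0, 1, 0; 1, 0, 0, 0; 0, 0, 0, 1; 0, 1, 0, 0] := by
  have h : (weylXi R σ)⁻¹ = weylOne R σ * weylTwo R σ := by
    rw [weylXi, _root_.mul_inv_rev, inv_eq_of_mul_eq_one_right (weylOne_mul_weylOne R σ), inv_eq_of_mul_eq_one_right (weylTwo_mul_weylTwo R σ)]
  rw [h, Subgroup.coe_mul, Units.val_mul, coe_weylTwo, coe_weylOne]
  ext i j
  fin_cases i <;> fin_cases j <;> simp [weylTwoM, weylOneM, Matrix.mul_apply, Fin.sum_univ_four]

/-- `ξ e₀ = e₂`: the first column of `ξ`. [cite: Xiong2013, §7 Lemma 7.1] -/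
theorem weylXiM_col_zero : (fun i => weylXiM R i 0) = ![0, 0, 1, 0] := by
  funext i; fin_cases i <;> simp [weylXiM]

/-- `ξ ∉ Q` (its first column is `e₂`; needs `(1 : R) ≠ 0`). [cite: Xiong2013, §7 Lemma 7.1] -/
theorem weylXi_not_mem_klingen [Nontrivial R] : weylXi R σ ∉ klingen R σ := by
  rw [mem_klingen_iff, coe_weylXi]
  simp [weylXiM]

/-- `ξ ∉ P`. [cite: Xiong2013, §7 Lemma 7.1] -/
theorem weylXi_not_mem_siegelFour [Nontrivial R] : weylXi R σ ∉ siegelFour R σ := by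
  rw [mem_siegelFour_iff, coe_weylXi]
  simp [weylXiM]

/-- **the root `e₁+e₂` is NOT flipped**: `ξ · u_{e₁+e₂}(z) = u_{e₁−e₂}(−σ z) · ξ`, so `ξ u_{e₁+e₂}(z) ξ⁻¹ ∈ P`. [cite: Casselman1980, §3] [cite: Xiong2013, §7 Lemma 7.1] -/
theorem weylXi_mul_uPlus (hσ : ∀ x, σ (σ x) = x) (z : R) : weylXi R σ * uPlus R σ hσ z = uMinus R σ hσ (-σ z) * weylXi R σ := by
  apply ext_of_coe
  rw [Subgroup.coe_mul, Units.val_mul, Subgroup.coe_mul, Units.val_mul, coe_weylXi, coe_uPlus, coe_uMinus]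
  ext i j
  fin_cases i <;> fin_cases j <;> simp [weylXiM, uPlusM, uMinusM, Matrix.mul_apply, Fin.sum_univ_four, hσ]

/-- **the root `2e₁` IS flipped**: `ξ u_{2e₁}(y) ξ⁻¹ = 1 + y E₂₁` is lower unitriangular, hence `∉ P` unless `y = 0`. [cite: Casselman1980, §3] [cite: Xiong2013, §7 Lemma 7.1] -/
theorem coe_weylXi_mul_uLongOne_mul_inv (y : R) (hy : σ y = -y) :
    ((((weylXi R σ * uLongOne R σ y hy * (weylXi R σ)⁻¹ : unitaryGroupOfForm σ _)) : GL (Fin 4) R) : Matrix (Fin 4) (Fin 4) R) =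
      !![1, 0, 0, 0; 0, 1, 0, 0; 0, y, 1, 0; 0, 0, 0, 1] := by
  rw [Subgroup.coe_mul, Units.val_mul, Subgroup.coe_mul, Units.val_mul, coe_weylXi, coe_uLongOne, coe_weylXi_inv]
  ext i j
  fin_cases i <;> fin_cases j <;> simp [weylXiM, uLongOneM, Matrix.mul_apply, Fin.sum_univ_four]

/-- **the root `e₁−e₂` IS flipped**: `ξ u_{e₁−e₂}(t) ξ⁻¹ = 1 + t E₂₀ − σ(t) E₃₁` is lower unitriangular. [cite: Casselman1980, §3] [cite: Xiong2013, §7 Lemma 7.1] -/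
theorem coe_weylXi_mul_uMinus_mul_inv (hσ : ∀ x, σ (σ x) = x) (t : R) :
    ((((weylXi R σ * uMinus R σ hσ t * (weylXi R σ)⁻¹ : unitaryGroupOfForm σ _)) : GL (Fin 4) R) : Matrix (Fin 4) (Fin 4) R) =
      !![1, 0, 0, 0; 0, 1, 0, 0; t, 0, 1, 0; 0, -σ t, 0, 1] := by
  rw [Subgroup.coe_mul, Units.val_mul, Subgroup.coe_mul, Units.val_mul, coe_weylXi, coe_uMinus, coe_weylXi_inv]
  ext i j
  fin_cases i <;> fin_cases j <;> simp [weylXiM, uMinusM, Matrix.mul_apply, Fin.sum_univ_four]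

/-- `ξ u_{2e₁}(y) ξ⁻¹ ∈ P ↔ y = 0` — the flipped root is a genuine integration variable. [cite: Casselman1980, §3] -/
theorem weylXi_conj_uLongOne_mem_siegelFour_iff (y : R) (hy : σ y = -y) :
    weylXi R σ * uLongOne R σ y hy * (weylXi R σ)⁻¹ ∈ siegelFour R σ ↔ y = 0 := by
  rw [mem_siegelFour_iff, coe_weylXi_mul_uLongOne_mul_inv]
  simp

/-- `ξ u_{e₁−e₂}(t) ξ⁻¹ ∈ P ↔ t = 0` (`σ` involutive, so `σ t = 0 ↔ t = 0`). [cite: Casselman1980, §3] -/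
theorem weylXi_conj_uMinus_mem_siegelFour_iff (hσ : ∀ x, σ (σ x) = x) (t : R) :
    weylXi R σ * uMinus R σ hσ t * (weylXi R σ)⁻¹ ∈ siegelFour R σ ↔ t = 0 := by
  rw [mem_siegelFour_iff, coe_weylXi_mul_uMinus_mul_inv hσ]
  simp only [Matrix.of_apply, Matrix.cons_val', Matrix.cons_val_zero, Matrix.cons_val_one, Matrix.cons_val, Matrix.empty_val',
    Matrix.cons_val_fin_one, neg_eq_zero, true_and]
  constructor
  · rintro ⟨ht, -⟩; exact ht
  · intro ht; refine ⟨ht, ?_⟩; rw [ht, map_zero]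

/-- **the GL₁-factor of the Klingen Levi is moved by `ξ` to the coordinate `2`**: `ξ · m_Q(a, 1) · ξ⁻¹ = diag(1, σ(a)⁻¹, a, 1) = m(diag(1, σ(a)⁻¹))`-type — recorded as
the matrix identity the modulus bookkeeping of the cell-`ξ` term reads (`‖a‖^{1−s}` vs `‖a‖^{s+1}`). [cite: Xiong2013, §4 Prop. 4.1] [cite: GanTakeda2011SiegelWeil, §7.2 p. 23] -/
theorem coe_weylXi_mul_klingenLevi_one_mul_inv (hσ : ∀ x, σ (σ x) = x) (a : Rˣ) :
    ((((weylXi R σ * klingenLevi R σ hσ a 1 * (weylXi R σ)⁻¹ : unitaryGroupOfForm σ _)) : GL (Fin 4) R) : Matrix (Fin 4) (Fin 4) R) =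
      !![1, 0, 0, 0; 0, σ ((a⁻¹ : Rˣ) : R), 0, 0; 0, 0, (a : R), 0; 0, 0, 0, 1] := by
  rw [Subgroup.coe_mul, Units.val_mul, Subgroup.coe_mul, Units.val_mul, coe_weylXi, coe_klingenLevi, coe_weylXi_inv]
  ext i j
  fin_cases i <;> fin_cases j <;> simp [weylXiM, klingenLeviM, Matrix.mul_apply, Fin.sum_univ_four]

end Summit.HodgeConjecture.HodgeConjecture.Cruxes.HLiu418.K2LiuKlingenParabolicDefs

end
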